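import Literature.MathematicalPhysics.QuantumLattice.Phi4NewmanGaussianInequality
import HarnessLib

/-!
# The Messager–Miracle-Solé inequality for real-valued lattice spins and the lattice `φ⁴` measure

Proofs-only file (topic `Literature/MathematicalPhysics/QuantumLattice`; theorems only, no definition,
no named fact). The reflection monotonicity of correlations for ferromagnetic nearest-neighbour
systems of **real-valued** spins with an even single-site distribution (Aizenman–Duminil-Copin
2021, §5.1, display (5.1): "`⟨∏_A τ ∏_B τ⟩_{Λ,ρ,β} ≥ ⟨∏_A τ ∏_{R(B)} τ⟩_{Λ,ρ,β}` for `A`, `B` on the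
same side of a reflection plane", after [Heg77, MesMir77, Sch77]), here for the two-point function,
which is the case used for Prop. 5.1 / (5.21) ibid. and hence for the variance bounds of p. 6.

## The statement proved (`integral_mul_sub_reflect_mul_boltzWeight_nonneg`, `phi4_twoPoint_reflect_le`)

Let `G` be a finite simple graph on `V`, `θ` an involution of `V` preserving adjacency, and `P` a
set of vertices ("the open positive side") with `θP ∩ P = ∅`, `V = P ∪ θP ∪ Fix(θ)`, and **no
bond joining `P` to `θP` except bonds `{u, θu}`** (the geometric condition of reflections of
`ℤᵈ` in hyperplanes through sites, through mid-edges, or diagonal ones, for the nearest-neighbour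
graph). Then for an even single-site potential `U` dominating Gaussians, `J ≥ 0`, `a ∈ P ∪ Fix(θ)`
and `b ∈ P`:

  `∫ φ_a φ_{θb} e^{J ∑_{E(G)} φφ} ∏ e^{-U(φ_w)} dφ ≤ ∫ φ_a φ_b e^{J ∑_{E(G)} φφ} ∏ e^{-U(φ_w)} dφ`,

and for the lattice `φ⁴` measure (`g > 0`): `⟨φ_a φ_{θb}⟩_{G;g,κ,J} ≤ ⟨φ_a φ_b⟩_{G;g,κ,J}`.

## Proof (Hegerfeldt 1977, §2, Lemma 2.1 and Main Lemma (2.8); Messager–Miracle-Solé 1977)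

The even/odd variables `s_u = ½(φ_u + φ_{θu})`, `t_u = ½(φ_u - φ_{θu})` (`u ∈ P`), `φ_f`
(`f` fixed): the linear change of variables `φ = Lψ` with `ψ_u = s_u`, `ψ_{θu} = t_u`, `ψ_f = φ_f`
(`L`, its inverse `M`; `|det L|⁻¹ > 0`, `exists_integral_comp_foldMap`). In the new variables
* the interaction, symmetrised as `½(H + H∘θ)` by the invariance of the graph
  (`pairInteraction_eq_half_sum_even_odd`), is a polynomial with nonnegative coefficients in `ψ`
  minus `J N(ψ)`, `N(ψ) = ∑_{u ∈ P, u ∼ θu} t_u² ≥ 0` collecting the crossing bonds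
  (`mul_pairInteraction_foldMap`, `crossSum_nonneg`);
* the a priori weight `∏_w e^{-U(φ_w)} = ∏_{u∈P} e^{-U(s_u+t_u)-U(s_u-t_u)} ∏_f e^{-U(ψ_f)}` and the
  factor `e^{-J N(ψ)}` are invariant under every single sign flip `ψ_s ↦ -ψ_s` (evenness of `U`;
  `sum_apply_foldMap_spinReflect`, `crossSum_spinReflect`) — so Lebesgue measure on `V → ℝ` with
  this weight is a Ginibre system in the sense of the tree's `IsGinibreSystem`
  (`isGinibreSystem_fold`), with the integrability hypothesis (4.1.4) (`integrable_fold`);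
* the observable is `φ_a(φ_b - φ_{θb}) = 2 t_b (s_a + t_a)` (resp. `2 t_b ψ_a`), nonnegative
  coefficients.
Hence the first Griffiths inequality of the folded system
(`IsGinibreSystem.integral_eval_mul_exp_mul_weight_nonneg`, Glimm–Jaffe Thm 4.1.1 in Ginibre's
form, already in the tree) gives `∫ φ_a(φ_b - φ_{θb}) dμ ≥ 0`.

## References

* A. Messager, S. Miracle-Solé, *Correlation functions and boundary conditions in the Ising
  ferromagnet*, J. Stat. Phys. 17 (1977) 245–262 [MessagerMiracleSoleJSP1977].
* G. C. Hegerfeldt, *Correlation inequalities for Ising ferromagnets with symmetries*, Comm. Math.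
  Phys. 57 (1977) 259–266, Lemma 2.1, Main Lemma (2.8), Thm 3.1–3.2 [Hegerfeldt1977] (held).
* M. Aizenman, H. Duminil-Copin, Ann. of Math. 194 (2021), arXiv:1912.07973, §5.1, (5.1) and
  Prop. 5.1 (p. 16: valid for "real valued spin variables satisfying (sub_gauss)", after
  [Heg77, MesMir77, Sch77]) [AizenmanDuminilCopinAnnals2021].
* J. Glimm, A. Jaffe, *Quantum Physics* (2nd ed. 1987), Thm 4.1.1 (p. 56) [GlimmJaffeQP1987] — the
  sign-symmetry mechanism, as formalised in `LatticeScalarFieldGriffithsProofs`.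

## Design

No definition is introduced: the folding map `L`, its inverse `M`, and the site/sign
bookkeeping `ρ, τ, ε` of the even/odd variables enter every internal lemma as function arguments
together with their defining equations (`hL`, `hM`, `hρ`, `hτ`, `hε`); the final theorems
instantiate them with the explicit lambda terms. Linear-map structure is built inside proofs. The tree's
Ising file `Literature/Probability/LatticeModels/MessagerMiracleSole.lean` proves the same
inequality for `±1` spins by the same mechanism; nothing is shared at the code level (there the
observables are `{-1,0,1}`-valued and GKS I is a finite sum).
-/

noncomputable section

open MeasureTheory Filter Topology Finset MvPolynomial

namespace Literature.MathematicalPhysics.QuantumLattice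

section Fold

variable {V : Type*} [Fintype V] [DecidableEq V]

/-- Splitting a sum over the sites along `V = P ⊔ θP ⊔ Fix(θ)`. [folklore] -/
theorem sum_fold_split (θ : Equiv.Perm V) (P : Finset V) (hθ : ∀ u, θ (θ u) = u)
    (hP : ∀ u ∈ P, θ u ∉ P) (hcov : ∀ u, u ∈ P ∨ θ u ∈ P ∨ θ u = u) (h : V → ℝ) :
    ∑ w, h w = ∑ u ∈ P, h u + ∑ u ∈ P, h (θ u) +
      ∑ f ∈ Finset.univ.filter (fun f => θ f = f), h f := by
  have hdisj1 : Disjoint P (P.image θ) := by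
    rw [Finset.disjoint_left]
    rintro u hu hu'
    obtain ⟨v, hv, rfl⟩ := Finset.mem_image.1 hu'
    exact hP v hv hu
  have hdisj2 : Disjoint (P ∪ P.image θ) (Finset.univ.filter fun f => θ f = f) := by
    rw [Finset.disjoint_left]
    intro u hu hf
    rw [Finset.mem_filter] at hf
    rcases Finset.mem_union.1 hu with h1 | h1
    · exact hP u h1 (hf.2.symm ▸ h1)
    · obtain ⟨v, hv, rfl⟩ := Finset.mem_image.1 h1
      have hv' : θ v = v := by
        have h3 := hf.2
        rw [hθ v] at h3
        exact h3.symm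
      exact hP v hv (hv'.symm ▸ hv)
  have hcover : (P ∪ P.image θ) ∪ (Finset.univ.filter fun f => θ f = f) = Finset.univ := by
    ext u
    simp only [Finset.mem_union, Finset.mem_image, Finset.mem_filter, Finset.mem_univ, true_and,
      iff_true]
    rcases hcov u with h | h | h
    · exact Or.inl (Or.inl h)
    · exact Or.inl (Or.inr ⟨θ u, h, hθ u⟩)
    · exact Or.inr h
  have himage : ∑ w ∈ P.image θ, h w = ∑ u ∈ P, h (θ u) :=
    Finset.sum_image fun u _ v _ huv => θ.injective huv
  calc ∑ w, h w = ∑ w ∈ (P ∪ P.image θ) ∪ (Finset.univ.filter fun f => θ f = f), h w := by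
        rw [hcover]
    _ = _ := by rw [Finset.sum_union hdisj2, Finset.sum_union hdisj1, himage]

variable (θ : Equiv.Perm V) (P : Finset V)

/-! ### The folding change of variables

`L` denotes the folding map `φ = Lψ`, `φ_u = ψ_u + ψ_{θu}`, `φ_{θu} = ψ_u - ψ_{θu}` (`u ∈ P`),
`φ_f = ψ_f` otherwise — so `ψ_u = s_u`, `ψ_{θu} = t_u` are Hegerfeldt's even/odd variables — and
`M` its inverse; both enter as function arguments with their defining equations `hL`, `hM`. -/

section Maps

variable (L M : (V → ℝ) → (V → ℝ))

omit [Fintype V] in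
/-- `L ∘ M = id`. [folklore] -/
theorem foldMap_unfoldMap (hθ : ∀ u, θ (θ u) = u) (hP : ∀ u ∈ P, θ u ∉ P)
    (hL : ∀ ψ w, L ψ w = if w ∈ P then ψ w + ψ (θ w) else if θ w ∈ P then ψ (θ w) - ψ w else ψ w)
    (hM : ∀ φ w, M φ w =
      if w ∈ P then (φ w + φ (θ w)) / 2 else if θ w ∈ P then (φ (θ w) - φ w) / 2 else φ w)
    (φ : V → ℝ) : L (M φ) = φ := by
  funext w
  rw [hL]
  by_cases hw : w ∈ P
  · have h1 : θ w ∉ P := hP w hw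
    rw [if_pos hw, hM, hM, if_pos hw, if_neg h1, hθ, if_pos hw]
    ring
  · by_cases hw' : θ w ∈ P
    · rw [if_neg hw, if_pos hw', hM, hM, if_pos hw', if_neg hw, if_pos hw', hθ]
      ring
    · rw [if_neg hw, if_neg hw', hM, if_neg hw, if_neg hw']

omit [Fintype V] in
/-- `M ∘ L = id`. [folklore] -/
theorem unfoldMap_foldMap (hθ : ∀ u, θ (θ u) = u) (hP : ∀ u ∈ P, θ u ∉ P)
    (hL : ∀ ψ w, L ψ w = if w ∈ P then ψ w + ψ (θ w) else if θ w ∈ P then ψ (θ w) - ψ w else ψ w)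
    (hM : ∀ φ w, M φ w =
      if w ∈ P then (φ w + φ (θ w)) / 2 else if θ w ∈ P then (φ (θ w) - φ w) / 2 else φ w)
    (ψ : V → ℝ) : M (L ψ) = ψ := by
  funext w
  rw [hM]
  by_cases hw : w ∈ P
  · have h1 : θ w ∉ P := hP w hw
    rw [if_pos hw, hL, hL, if_pos hw, if_neg h1, hθ, if_pos hw]
    ring
  · by_cases hw' : θ w ∈ P
    · rw [if_neg hw, if_pos hw', hL, hL, if_pos hw', if_neg hw, if_pos hw', hθ]
      ring
    · rw [if_neg hw, if_neg hw', hL, if_neg hw, if_neg hw']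

/-- **The folding change of variables in Lebesgue integrals**: there is `c > 0` (namely
`|det L|⁻¹`) with `∫ F(Lψ) dψ = c ∫ F(φ) dφ` for all `F`, and `F ∘ L` is integrable iff `F` is.
[folklore] -/
theorem exists_integral_comp_foldMap (hθ : ∀ u, θ (θ u) = u) (hP : ∀ u ∈ P, θ u ∉ P)
    (hL : ∀ ψ w, L ψ w = if w ∈ P then ψ w + ψ (θ w) else if θ w ∈ P then ψ (θ w) - ψ w else ψ w) :
    ∃ c : ℝ, 0 < c ∧ ∀ F : (V → ℝ) → ℝ,
      (∫ ψ, F (L ψ) = c * ∫ φ, F φ) ∧ (Integrable (fun ψ => F (L ψ)) ↔ Integrable F) := by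
  set M : (V → ℝ) → (V → ℝ) := fun φ w =>
    if w ∈ P then (φ w + φ (θ w)) / 2 else if θ w ∈ P then (φ (θ w) - φ w) / 2 else φ w with hMdef
  have hM : ∀ φ w, M φ w =
      if w ∈ P then (φ w + φ (θ w)) / 2 else if θ w ∈ P then (φ (θ w) - φ w) / 2 else φ w :=
    fun _ _ => rfl
  -- the two maps as linear maps, inverse to each other
  let Ll : (V → ℝ) →ₗ[ℝ] (V → ℝ) :=
    { toFun := L
      map_add' := fun ψ χ => by
        funext w
        change L (ψ + χ) w = L ψ w + L χ w
        simp only [hL, Pi.add_apply]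
        split_ifs <;> ring
      map_smul' := fun c ψ => by
        funext w
        change L (c • ψ) w = c * L ψ w
        simp only [hL, Pi.smul_apply, smul_eq_mul]
        split_ifs <;> ring }
  let Ml : (V → ℝ) →ₗ[ℝ] (V → ℝ) :=
    { toFun := M
      map_add' := fun ψ χ => by
        funext w
        change M (ψ + χ) w = M ψ w + M χ w
        simp only [hM, Pi.add_apply]
        split_ifs <;> ring
      map_smul' := fun c ψ => by
        funext w
        change M (c • ψ) w = c * M ψ w
        simp only [hM, Pi.smul_apply, smul_eq_mul]
        split_ifs <;> ring }
  have hLM : Ll.comp Ml = LinearMap.id :=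
    LinearMap.ext fun φ => foldMap_unfoldMap θ P L M hθ hP hL hM φ
  have hML : Ml.comp Ll = LinearMap.id :=
    LinearMap.ext fun ψ => unfoldMap_foldMap θ P L M hθ hP hL hM ψ
  let e : (V → ℝ) ≃ₗ[ℝ] (V → ℝ) := LinearEquiv.ofLinear Ll Ml hLM hML
  have hdet : LinearMap.det Ll ≠ 0 := e.isUnit_det'.ne_zero
  have hemb : MeasurableEmbedding (Ll : (V → ℝ) → (V → ℝ)) :=
    (LinearMap.equivOfDetNeZero Ll hdet).toContinuousLinearEquiv.toHomeomorph.measurableEmbedding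
  refine ⟨|(LinearMap.det Ll)⁻¹|, abs_pos.2 (inv_ne_zero hdet), fun F => ⟨?_, ?_⟩⟩
  · change ∫ ψ, F (Ll ψ) = _
    rw [← hemb.integral_map, Measure.map_linearMap_addHaar_eq_smul_addHaar _ hdet,
      integral_smul_measure, ENNReal.toReal_ofReal (abs_nonneg _), smul_eq_mul]
  · change Integrable (F ∘ Ll) volume ↔ _
    rw [← hemb.integrable_map_iff, Measure.map_linearMap_addHaar_eq_smul_addHaar _ hdet,
      integrable_smul_measure (by simp [hdet]) ENNReal.ofReal_ne_top]

end Maps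

/-! ### The even/odd variables of all sites and the folded pair interaction

`ρ x` is the site carrying the even variable `S_x = ½(φ_x + φ_{θx})` of `x` in the folded
coordinates (`x` on `P` and `Fix(θ)`, `θx` on `θP`), `τ x` the site carrying the odd variable
`T_x = ½(φ_x - φ_{θx})` (`θx` on `P`, `x` on `θP`) and `ε x ∈ {1, -1, 0}` its sign. -/

section EvenOdd

variable (L : (V → ℝ) → (V → ℝ)) (ρ τ : V → V) (ε : V → ℝ)

omit [Fintype V] in
/-- **The even variable of every site in the folded coordinates**: `½(φ_x + φ_{θx}) = ψ_{ρ x}`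
for `φ = Lψ`. [cite: Hegerfeldt1977, §2 (the variables x_i + x_i')] -/
theorem half_add_foldMap (hθ : ∀ u, θ (θ u) = u) (hP : ∀ u ∈ P, θ u ∉ P)
    (hcov : ∀ u, u ∈ P ∨ θ u ∈ P ∨ θ u = u)
    (hL : ∀ ψ w, L ψ w = if w ∈ P then ψ w + ψ (θ w) else if θ w ∈ P then ψ (θ w) - ψ w else ψ w)
    (hρ : ∀ x, ρ x = if x ∈ P then x else if θ x ∈ P then θ x else x) (ψ : V → ℝ) (x : V) :
    (L ψ x + L ψ (θ x)) / 2 = ψ (ρ x) := by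
  by_cases hx : x ∈ P
  · have h1 : θ x ∉ P := hP x hx
    simp only [hL, hρ, hx, h1, hθ, if_true, if_false]
    ring
  · by_cases hx' : θ x ∈ P
    · simp only [hL, hρ, hx, hx', hθ, if_true, if_false]
      ring
    · have hfix : θ x = x := by
        rcases hcov x with h | h | h
        · exact absurd h hx
        · exact absurd h hx'
        · exact h
      simp only [hL, hρ, hfix, hx, if_false]
      ring

omit [Fintype V] in
/-- **The odd variable of every site in the folded coordinates**:
`½(φ_x - φ_{θx}) = ε(x) ψ_{τ x}` for `φ = Lψ`. [cite: Hegerfeldt1977, §2 (the variables x_i - x_i')] -/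
theorem half_sub_foldMap (hθ : ∀ u, θ (θ u) = u) (hP : ∀ u ∈ P, θ u ∉ P)
    (hcov : ∀ u, u ∈ P ∨ θ u ∈ P ∨ θ u = u)
    (hL : ∀ ψ w, L ψ w = if w ∈ P then ψ w + ψ (θ w) else if θ w ∈ P then ψ (θ w) - ψ w else ψ w)
    (hτ : ∀ x, τ x = if x ∈ P then θ x else x)
    (hε : ∀ x, ε x = if x ∈ P then 1 else if θ x ∈ P then -1 else 0) (ψ : V → ℝ) (x : V) :
    (L ψ x - L ψ (θ x)) / 2 = ε x * ψ (τ x) := by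
  by_cases hx : x ∈ P
  · have h1 : θ x ∉ P := hP x hx
    simp only [hL, hτ, hε, hx, h1, hθ, if_true, if_false]
    ring
  · by_cases hx' : θ x ∈ P
    · simp only [hL, hτ, hε, hx, hx', hθ, if_true, if_false]
      ring
    · have hfix : θ x = x := by
        rcases hcov x with h | h | h
        · exact absurd h hx
        · exact absurd h hx'
        · exact h
      simp only [hL, hτ, hε, hfix, hx, if_false]
      ring

omit [Fintype V] in
/-- Products of signs take the values `1, -1, 0`. [folklore] -/
theorem sgn_mul_sgn_trichotomy (hε : ∀ x, ε x = if x ∈ P then 1 else if θ x ∈ P then -1 else 0)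
    (x y : V) : ε x * ε y = 1 ∨ ε x * ε y = -1 ∨ ε x * ε y = 0 := by
  have h3 : ∀ z, ε z = 1 ∨ ε z = -1 ∨ ε z = 0 := fun z => by
    rw [hε]; split_ifs <;> simp
  rcases h3 x with h | h | h <;> rcases h3 y with h' | h' | h' <;> simp [h, h']

omit [Fintype V] in
/-- **Opposite signs on adjacent sites only along the bonds `{u, θu}`** (the geometric condition:
no bond joins `P` to `θP` except `{u, θu}`). [cite: MessagerMiracleSoleJSP1977, main theorem (condition on the reflection)] -/
theorem eq_reflect_of_sgn_mul_eq_neg_one {G : SimpleGraph V} (hθ : ∀ u, θ (θ u) = u)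
    (hedge : ∀ u ∈ P, ∀ v ∈ P, G.Adj u (θ v) → u = v)
    (hε : ∀ x, ε x = if x ∈ P then 1 else if θ x ∈ P then -1 else 0) {x y : V} (hxy : G.Adj x y)
    (hs : ε x * ε y = -1) : y = θ x := by
  rw [hε, hε] at hs
  by_cases hx : x ∈ P
  · by_cases hy : y ∈ P
    · norm_num [hx, hy] at hs
    · by_cases hy' : θ y ∈ P
      · have h := hedge x hx (θ y) hy' (by rw [hθ]; exact hxy)
        rw [h, hθ]
      · norm_num [hx, hy, hy'] at hs
  · by_cases hx' : θ x ∈ P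
    · by_cases hy : y ∈ P
      · exact hedge y hy (θ x) hx' (by rw [hθ]; exact hxy.symm)
      · by_cases hy' : θ y ∈ P
        · norm_num [hx, hx', hy, hy'] at hs
        · norm_num [hx, hx', hy, hy'] at hs
    · norm_num [hx, hx'] at hs

omit [Fintype V] in
/-- If `ε x ε y = -1` for adjacent `x, y` then the odd variables of `x` and `y` coincide:
`τ y = τ x`. [folklore] -/
theorem tau_eq_of_sgn_mul_eq_neg_one {G : SimpleGraph V} (hθ : ∀ u, θ (θ u) = u)
    (hP : ∀ u ∈ P, θ u ∉ P) (hedge : ∀ u ∈ P, ∀ v ∈ P, G.Adj u (θ v) → u = v)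
    (hτ : ∀ x, τ x = if x ∈ P then θ x else x)
    (hε : ∀ x, ε x = if x ∈ P then 1 else if θ x ∈ P then -1 else 0) {x y : V} (hxy : G.Adj x y)
    (hs : ε x * ε y = -1) : τ y = τ x := by
  have hyx : y = θ x := eq_reflect_of_sgn_mul_eq_neg_one θ P ε hθ hedge hε hxy hs
  rw [hyx, hτ, hτ]
  by_cases hx : x ∈ P
  · rw [if_neg (hP x hx), if_pos hx]
  · by_cases hx' : θ x ∈ P
    · rw [if_pos hx', hθ, if_neg hx]
    · exfalso
      rw [hε, hε, if_neg hx, if_neg hx'] at hs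
      norm_num at hs

variable (G : SimpleGraph V) [DecidableRel G.Adj]

/-- **Symmetrisation of the pair interaction under the reflection** (`H = ½(H + H∘θ)` by the
invariance of the graph): `∑_{E(G)} φφ = ½ ∑ₓ∑_y [x∼y] (S_xS_y + T_xT_y)` with
`S_z = ½(φ_z + φ_{θz})`, `T_z = ½(φ_z - φ_{θz})` for **all** sites `z`. [cite: MessagerMiracleSoleJSP1977, main theorem (proof: the change of variables)] -/
theorem pairInteraction_eq_half_sum_even_odd (hadj : ∀ x y, G.Adj (θ x) (θ y) ↔ G.Adj x y)
    (φ : V → ℝ) :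
    pairInteraction G φ = 1 / 2 * ∑ x, ∑ y, if G.Adj x y then
      ((φ x + φ (θ x)) / 2 * ((φ y + φ (θ y)) / 2) +
        (φ x - φ (θ x)) / 2 * ((φ y - φ (θ y)) / 2)) else 0 := by
  classical
  have hmain := mul_pairInteraction_eq_half_sum_adj G 1 φ
  rw [one_mul] at hmain
  have hrefl : ∑ x, ∑ y, (if G.Adj x y then φ (θ x) * φ (θ y) else 0) =
      ∑ x, ∑ y, (if G.Adj x y then φ x * φ y else 0) := by
    refine Fintype.sum_equiv θ _ _ fun x => Fintype.sum_equiv θ _ _ fun y => ?_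
    simp only [hadj]
  have hsum : ∑ x, ∑ y, (if G.Adj x y then
      ((φ x + φ (θ x)) / 2 * ((φ y + φ (θ y)) / 2) +
        (φ x - φ (θ x)) / 2 * ((φ y - φ (θ y)) / 2)) else 0) =
      1 / 2 * ((∑ x, ∑ y, if G.Adj x y then φ x * φ y else 0) +
        ∑ x, ∑ y, if G.Adj x y then φ (θ x) * φ (θ y) else 0) := by
    rw [← Finset.sum_add_distrib, Finset.mul_sum]
    refine Finset.sum_congr rfl fun x _ => ?_
    rw [← Finset.sum_add_distrib, Finset.mul_sum]
    refine Finset.sum_congr rfl fun y _ => ?_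
    split_ifs <;> ring
  rw [hsum, hrefl, hmain]
  ring

/-- **The pair interaction in the folded coordinates**: `J ∑_{E(G)} φφ = H'(ψ) - J N(ψ)` for
`φ = Lψ`, where `H'(ψ) = (J/2) ∑ₓ∑_y [x∼y] (ψ_{ρx} ψ_{ρy} + [ε x ε y = 1] ψ_{τx} ψ_{τy})` has
nonnegative coefficients and `N(ψ) = ½ ∑ₓ∑_y [x∼y][ε x ε y = -1] ψ_{τx} ψ_{τy}` collects the
crossing bonds `{u, θu}` (`= ∑_{u∈P, u∼θu} t_u²`). [cite: Hegerfeldt1977, §2, Main Lemma (2.8)] -/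
theorem mul_pairInteraction_foldMap (hθ : ∀ u, θ (θ u) = u) (hP : ∀ u ∈ P, θ u ∉ P)
    (hcov : ∀ u, u ∈ P ∨ θ u ∈ P ∨ θ u = u) (hadj : ∀ x y, G.Adj (θ x) (θ y) ↔ G.Adj x y)
    (hL : ∀ ψ w, L ψ w = if w ∈ P then ψ w + ψ (θ w) else if θ w ∈ P then ψ (θ w) - ψ w else ψ w)
    (hρ : ∀ x, ρ x = if x ∈ P then x else if θ x ∈ P then θ x else x)
    (hτ : ∀ x, τ x = if x ∈ P then θ x else x)
    (hε : ∀ x, ε x = if x ∈ P then 1 else if θ x ∈ P then -1 else 0) (J : ℝ) (ψ : V → ℝ) :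
    J * pairInteraction G (L ψ) =
      J / 2 * (∑ x, ∑ y, if G.Adj x y then
        (ψ (ρ x) * ψ (ρ y) + (if ε x * ε y = 1 then ψ (τ x) * ψ (τ y) else 0)) else 0) -
      J * (1 / 2 * ∑ x, ∑ y, if G.Adj x y then
        (if ε x * ε y = -1 then ψ (τ x) * ψ (τ y) else 0) else 0) := by
  rw [pairInteraction_eq_half_sum_even_odd θ G hadj]
  simp_rw [half_add_foldMap θ P L ρ hθ hP hcov hL hρ ψ, half_sub_foldMap θ P L τ ε hθ hP hcov hL hτ hε ψ]
  rw [show ∀ A B : ℝ, J / 2 * A - J * (1 / 2 * B) = J * (1 / 2 * (A - B)) by intros; ring]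
  congr 2
  rw [← Finset.sum_sub_distrib]
  refine Finset.sum_congr rfl fun x _ => ?_
  rw [← Finset.sum_sub_distrib]
  refine Finset.sum_congr rfl fun y _ => ?_
  by_cases hxy : G.Adj x y
  · simp only [if_pos hxy]
    have key : ε x * ψ (τ x) * (ε y * ψ (τ y)) =
        (if ε x * ε y = 1 then ψ (τ x) * ψ (τ y) else 0) -
          (if ε x * ε y = -1 then ψ (τ x) * ψ (τ y) else 0) := by
      rcases sgn_mul_sgn_trichotomy θ P ε hε x y with h | h | h
      · have h1 : ε x * ε y ≠ -1 := by rw [h]; norm_num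
        rw [if_pos h, if_neg h1]
        calc _ = (ε x * ε y) * (ψ (τ x) * ψ (τ y)) := by ring
          _ = _ := by rw [h]; ring
      · have h1 : ε x * ε y ≠ 1 := by rw [h]; norm_num
        rw [if_neg h1, if_pos h]
        calc _ = (ε x * ε y) * (ψ (τ x) * ψ (τ y)) := by ring
          _ = _ := by rw [h]; ring
      · have h1 : ε x * ε y ≠ 1 := by rw [h]; norm_num
        have h2 : ε x * ε y ≠ -1 := by rw [h]; norm_num
        rw [if_neg h1, if_neg h2]
        calc _ = (ε x * ε y) * (ψ (τ x) * ψ (τ y)) := by ring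
          _ = _ := by rw [h]; ring
    rw [key]
    ring
  · simp only [if_neg hxy, sub_zero]

/-! ### The crossing bonds: `N(ψ) = ∑_{u ∈ P, u ∼ θu} t_u²` is nonnegative and even -/

omit [Fintype V] in
/-- Each crossing term is a square:
`[x∼y][ε x ε y = -1] ψ_{τx} ψ_{τy} = [x∼y][ε x ε y = -1] ψ_{τx}²`. [folklore] -/
theorem crossTerm_eq_sq (hθ : ∀ u, θ (θ u) = u) (hP : ∀ u ∈ P, θ u ∉ P)
    (hedge : ∀ u ∈ P, ∀ v ∈ P, G.Adj u (θ v) → u = v)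
    (hτ : ∀ x, τ x = if x ∈ P then θ x else x)
    (hε : ∀ x, ε x = if x ∈ P then 1 else if θ x ∈ P then -1 else 0) (ψ : V → ℝ) (x y : V) :
    (if G.Adj x y then (if ε x * ε y = -1 then ψ (τ x) * ψ (τ y) else 0) else 0) =
      if G.Adj x y then (if ε x * ε y = -1 then ψ (τ x) ^ 2 else 0) else 0 := by
  by_cases hxy : G.Adj x y
  · simp only [if_pos hxy]
    by_cases hs : ε x * ε y = -1
    · rw [if_pos hs, if_pos hs, tau_eq_of_sgn_mul_eq_neg_one θ P τ ε hθ hP hedge hτ hε hxy hs, sq]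
    · rw [if_neg hs, if_neg hs]
  · simp only [if_neg hxy]

/-- `N(ψ) ≥ 0`. [folklore] -/
theorem crossSum_nonneg (hθ : ∀ u, θ (θ u) = u) (hP : ∀ u ∈ P, θ u ∉ P)
    (hedge : ∀ u ∈ P, ∀ v ∈ P, G.Adj u (θ v) → u = v)
    (hτ : ∀ x, τ x = if x ∈ P then θ x else x)
    (hε : ∀ x, ε x = if x ∈ P then 1 else if θ x ∈ P then -1 else 0) (ψ : V → ℝ) :
    0 ≤ 1 / 2 * ∑ x, ∑ y, if G.Adj x y then
      (if ε x * ε y = -1 then ψ (τ x) * ψ (τ y) else 0) else 0 := by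
  simp_rw [crossTerm_eq_sq θ P τ ε G hθ hP hedge hτ hε ψ]
  refine mul_nonneg (by norm_num) (Finset.sum_nonneg fun x _ => Finset.sum_nonneg fun y _ => ?_)
  split_ifs
  · exact sq_nonneg _
  · exact le_rfl
  · exact le_rfl

/-- `N` is invariant under every single sign flip `ψ_s ↦ -ψ_s`. [folklore] -/
theorem crossSum_spinReflect (hθ : ∀ u, θ (θ u) = u) (hP : ∀ u ∈ P, θ u ∉ P)
    (hedge : ∀ u ∈ P, ∀ v ∈ P, G.Adj u (θ v) → u = v)
    (hτ : ∀ x, τ x = if x ∈ P then θ x else x)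
    (hε : ∀ x, ε x = if x ∈ P then 1 else if θ x ∈ P then -1 else 0) (s : V) (ψ : V → ℝ) :
    (1 / 2 * ∑ x, ∑ y, if G.Adj x y then
      (if ε x * ε y = -1 then spinReflect s ψ (τ x) * spinReflect s ψ (τ y) else 0) else 0) =
      1 / 2 * ∑ x, ∑ y, if G.Adj x y then
        (if ε x * ε y = -1 then ψ (τ x) * ψ (τ y) else 0) else 0 := by
  simp_rw [crossTerm_eq_sq θ P τ ε G hθ hP hedge hτ hε]
  congr 1
  refine Finset.sum_congr rfl fun x _ => Finset.sum_congr rfl fun y _ => ?_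
  have hsq : spinReflect s ψ (τ x) ^ 2 = ψ (τ x) ^ 2 := by
    rw [spinReflect_apply]
    split_ifs with h
    · rw [h, neg_sq]
    · rfl
  rw [hsq]

end EvenOdd

/-! ### The a priori weight in the folded coordinates is even in every variable -/

section Weight

variable (L : (V → ℝ) → (V → ℝ))

omit [Fintype V] in
/-- Flipping an even variable `s_u` (`s = u ∈ P`): `L(ψ with ψ_s ↦ -ψ_s)` exchanges and negates
the coordinates `s`, `θs` of `Lψ`. [cite: Hegerfeldt1977, Lemma 2.1 (sign symmetries)] -/
theorem foldMap_spinReflect_of_mem (hθ : ∀ u, θ (θ u) = u) (hP : ∀ u ∈ P, θ u ∉ P)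
    (hL : ∀ ψ w, L ψ w = if w ∈ P then ψ w + ψ (θ w) else if θ w ∈ P then ψ (θ w) - ψ w else ψ w)
    {s : V} (hs : s ∈ P) (ψ : V → ℝ) (w : V) :
    L (spinReflect s ψ) w =
      if w = s then -L ψ (θ s) else if w = θ s then -L ψ s else L ψ w := by
  have hθs : θ s ∉ P := hP s hs
  have hsθ : θ s ≠ s := fun h => hθs (h.symm ▸ hs)
  by_cases hw : w = s
  · subst hw
    rw [if_pos rfl, hL, hL, if_pos hs, if_neg hθs, hθ, if_pos hs, spinReflect_apply,
      spinReflect_apply, if_pos rfl, if_neg hsθ]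
    ring
  · by_cases hw' : w = θ s
    · subst hw'
      rw [if_neg hw, if_pos rfl, hL, hL, if_neg hθs, hθ, if_pos hs, if_pos hs, spinReflect_apply,
        spinReflect_apply, if_pos rfl, if_neg hsθ]
      ring
    · have h1 : θ w ≠ s := fun h => hw' (by rw [← h, hθ])
      rw [if_neg hw, if_neg hw', hL, hL, spinReflect_apply, spinReflect_apply, if_neg hw, if_neg h1]

omit [Fintype V] in
/-- Flipping an odd variable `t_u` (`s = θu`, `u ∈ P`): `L(ψ with ψ_s ↦ -ψ_s)` exchanges the
coordinates `u`, `θu` of `Lψ`. [cite: Hegerfeldt1977, Lemma 2.1 (sign symmetries)] -/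
theorem foldMap_spinReflect_of_reflect_mem (hθ : ∀ u, θ (θ u) = u) (hP : ∀ u ∈ P, θ u ∉ P)
    (hL : ∀ ψ w, L ψ w = if w ∈ P then ψ w + ψ (θ w) else if θ w ∈ P then ψ (θ w) - ψ w else ψ w)
    {s : V} (hs : θ s ∈ P) (ψ : V → ℝ) (w : V) :
    L (spinReflect s ψ) w =
      if w = θ s then L ψ s else if w = s then L ψ (θ s) else L ψ w := by
  have hsP : s ∉ P := fun h => hP s h hs
  have hsθ : θ s ≠ s := fun h => hsP (h ▸ hs)
  by_cases hw : w = θ s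
  · subst hw
    rw [if_pos rfl, hL, hL, if_pos hs, hθ, if_neg hsP, if_pos hs, spinReflect_apply,
      spinReflect_apply, if_neg hsθ, if_pos rfl]
    ring
  · by_cases hw' : w = s
    · subst hw'
      rw [if_neg hw, if_pos rfl, hL, hL, if_neg hsP, if_pos hs, if_pos hs, hθ, spinReflect_apply,
        spinReflect_apply, if_neg hsθ, if_pos rfl]
      ring
    · have h1 : θ w ≠ s := fun h => hw (by rw [← h, hθ])
      rw [if_neg hw, if_neg hw', hL, hL, spinReflect_apply, spinReflect_apply, if_neg hw', if_neg h1]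

omit [Fintype V] in
/-- Flipping a fixed variable `ψ_f` (`θf = f`): `L(ψ with ψ_f ↦ -ψ_f)` negates the coordinate `f`
of `Lψ`. [cite: Hegerfeldt1977, Lemma 2.1 (sign symmetries)] -/
theorem foldMap_spinReflect_of_fixed (hθ : ∀ u, θ (θ u) = u) (hP : ∀ u ∈ P, θ u ∉ P)
    (hL : ∀ ψ w, L ψ w = if w ∈ P then ψ w + ψ (θ w) else if θ w ∈ P then ψ (θ w) - ψ w else ψ w)
    {s : V} (hs : θ s = s) (ψ : V → ℝ) (w : V) :
    L (spinReflect s ψ) w = if w = s then -L ψ s else L ψ w := by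
  have hsP : s ∉ P := fun h => hP s h (hs.symm ▸ h)
  by_cases hw : w = s
  · subst hw
    simp only [hL, hsP, hs, if_false, if_true, spinReflect_apply]
  · have h1 : θ w ≠ s := fun h => hw (by rw [← hθ w, h, hs])
    rw [if_neg hw, hL, hL, spinReflect_apply, spinReflect_apply, if_neg hw, if_neg h1]

/-- **The a priori measure is even in the folded variables**: for an even `U`,
`∑_w U((L ψ')_w) = ∑_w U((Lψ)_w)` when `ψ'` is `ψ` with one coordinate negated (Hegerfeldt 1977,
Lemma 2.1: `∫(x+x')ⁿ(x-x')ᵐ dν dν` is symmetric under `x ↔ x'`, `(x,x') ↦ -(x,x')`). [cite: Hegerfeldt1977, Lemma 2.1] -/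
theorem sum_apply_foldMap_spinReflect (hθ : ∀ u, θ (θ u) = u) (hP : ∀ u ∈ P, θ u ∉ P)
    (hcov : ∀ u, u ∈ P ∨ θ u ∈ P ∨ θ u = u)
    (hL : ∀ ψ w, L ψ w = if w ∈ P then ψ w + ψ (θ w) else if θ w ∈ P then ψ (θ w) - ψ w else ψ w)
    {U : ℝ → ℝ} (hU : ∀ x, U (-x) = U x) (s : V) (ψ : V → ℝ) :
    ∑ w, U (L (spinReflect s ψ) w) = ∑ w, U (L ψ w) := by
  rcases hcov s with hs | hs | hs
  · calc ∑ w, U (L (spinReflect s ψ) w) = ∑ w, U (L ψ (Equiv.swap s (θ s) w)) := by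
          refine Finset.sum_congr rfl fun w _ => ?_
          rw [foldMap_spinReflect_of_mem θ P L hθ hP hL hs ψ w]
          by_cases hw : w = s
          · subst hw; rw [if_pos rfl, Equiv.swap_apply_left, hU]
          · by_cases hw' : w = θ s
            · subst hw'; rw [if_neg hw, if_pos rfl, Equiv.swap_apply_right, hU]
            · rw [if_neg hw, if_neg hw', Equiv.swap_apply_of_ne_of_ne hw hw']
      _ = ∑ w, U (L ψ w) := Equiv.sum_comp (Equiv.swap s (θ s)) (fun w => U (L ψ w))
  · calc ∑ w, U (L (spinReflect s ψ) w) = ∑ w, U (L ψ (Equiv.swap s (θ s) w)) := by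
          refine Finset.sum_congr rfl fun w _ => ?_
          rw [foldMap_spinReflect_of_reflect_mem θ P L hθ hP hL hs ψ w]
          by_cases hw : w = θ s
          · subst hw; rw [if_pos rfl, Equiv.swap_apply_right]
          · by_cases hw' : w = s
            · subst hw'; rw [if_neg hw, if_pos rfl, Equiv.swap_apply_left]
            · rw [if_neg hw, if_neg hw', Equiv.swap_apply_of_ne_of_ne hw' hw]
      _ = ∑ w, U (L ψ w) := Equiv.sum_comp (Equiv.swap s (θ s)) (fun w => U (L ψ w))
  · refine Finset.sum_congr rfl fun w _ => ?_
    rw [foldMap_spinReflect_of_fixed θ P L hθ hP hL hs ψ w]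
    split_ifs with hw
    · subst hw; exact hU _
    · rfl

end Weight

/-! ### Bounds used for integrability -/

section Bounds

variable (M : (V → ℝ) → (V → ℝ))

omit [Fintype V] in
/-- Pointwise bound for the unfolding map: `(Mφ)_w² ≤ ½(φ_w² + φ_{θw}²)`. [folklore] -/
theorem unfoldMap_sq_le (hcov : ∀ u, u ∈ P ∨ θ u ∈ P ∨ θ u = u)
    (hM : ∀ φ w, M φ w =
      if w ∈ P then (φ w + φ (θ w)) / 2 else if θ w ∈ P then (φ (θ w) - φ w) / 2 else φ w)
    (φ : V → ℝ) (w : V) : M φ w ^ 2 ≤ (φ w ^ 2 + φ (θ w) ^ 2) / 2 := by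
  rw [hM]
  by_cases hw : w ∈ P
  · rw [if_pos hw]
    nlinarith [sq_nonneg (φ w - φ (θ w))]
  · by_cases hw' : θ w ∈ P
    · rw [if_neg hw, if_pos hw']
      nlinarith [sq_nonneg (φ w + φ (θ w))]
    · have hfix : θ w = w := by
        rcases hcov w with h | h | h
        · exact absurd h hw
        · exact absurd h hw'
        · exact h
      rw [if_neg hw, if_neg hw', hfix]
      nlinarith

/-- `∑_w (Mφ)_w² ≤ ∑_w φ_w²`. [folklore] -/
theorem sum_unfoldMap_sq_le (hcov : ∀ u, u ∈ P ∨ θ u ∈ P ∨ θ u = u)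
    (hM : ∀ φ w, M φ w =
      if w ∈ P then (φ w + φ (θ w)) / 2 else if θ w ∈ P then (φ (θ w) - φ w) / 2 else φ w)
    (φ : V → ℝ) : ∑ w, M φ w ^ 2 ≤ ∑ w, φ w ^ 2 := by
  calc ∑ w, M φ w ^ 2 ≤ ∑ w, (φ w ^ 2 + φ (θ w) ^ 2) / 2 :=
        Finset.sum_le_sum fun w _ => unfoldMap_sq_le θ P M hcov hM φ w
    _ = ∑ w, φ w ^ 2 := by
        rw [← Finset.sum_div, Finset.sum_add_distrib, Equiv.sum_comp θ (fun w => φ w ^ 2)]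
        ring

end Bounds

/-! ### The folded system is a Ginibre system; integrability -/

section Ginibre

variable (L : (V → ℝ) → (V → ℝ)) (τ : V → V) (ε : V → ℝ) (G : SimpleGraph V) [DecidableRel G.Adj]

omit [Fintype V] in
/-- Each coordinate of the folding map is measurable. [folklore] -/
theorem measurable_apply_foldMap
    (hL : ∀ ψ w, L ψ w = if w ∈ P then ψ w + ψ (θ w) else if θ w ∈ P then ψ (θ w) - ψ w else ψ w)
    (w : V) : Measurable fun ψ : V → ℝ => L ψ w := by
  have hfun : (fun ψ : V → ℝ => L ψ w) = fun ψ =>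
      if w ∈ P then ψ w + ψ (θ w) else if θ w ∈ P then ψ (θ w) - ψ w else ψ w := by
    funext ψ; exact hL ψ w
  rw [hfun]
  split_ifs
  · exact (measurable_pi_apply w).add (measurable_pi_apply (θ w))
  · exact (measurable_pi_apply (θ w)).sub (measurable_pi_apply w)
  · exact measurable_pi_apply w

omit [DecidableEq V] in
/-- The crossing sum `N(ψ)` is a measurable function of `ψ`. [folklore] -/
theorem measurable_crossSum :
    Measurable fun ψ : V → ℝ => 1 / 2 * ∑ x, ∑ y, if G.Adj x y then
      (if ε x * ε y = -1 then ψ (τ x) * ψ (τ y) else 0) else 0 := by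
  refine Measurable.const_mul (Finset.measurable_sum _ fun x _ =>
    Finset.measurable_sum _ fun y _ => ?_) _
  by_cases hxy : G.Adj x y
  · simp only [if_pos hxy]
    by_cases hs : ε x * ε y = -1
    · simp only [if_pos hs]
      exact (measurable_pi_apply (τ x)).mul (measurable_pi_apply (τ y))
    · simp only [if_neg hs]
      exact measurable_const
  · simp only [if_neg hxy]
    exact measurable_const

/-- **The folded system is a Ginibre system** (Lebesgue measure on `V → ℝ`, coordinates `ψ`,
single sign flips, weight `e^{-J N(ψ)} ∏_w e^{-U((Lψ)_w)}`): the weight is even in every `ψ_s`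
(Hegerfeldt 1977, Lemma 2.1; Glimm–Jaffe 1987, Thm 4.1.1 for the mechanism). [cite: Hegerfeldt1977, Lemma 2.1 and Main Lemma (2.8)] -/
theorem isGinibreSystem_fold (hθ : ∀ u, θ (θ u) = u) (hP : ∀ u ∈ P, θ u ∉ P)
    (hcov : ∀ u, u ∈ P ∨ θ u ∈ P ∨ θ u = u)
    (hedge : ∀ u ∈ P, ∀ v ∈ P, G.Adj u (θ v) → u = v)
    (hL : ∀ ψ w, L ψ w = if w ∈ P then ψ w + ψ (θ w) else if θ w ∈ P then ψ (θ w) - ψ w else ψ w)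
    (hτ : ∀ x, τ x = if x ∈ P then θ x else x)
    (hε : ∀ x, ε x = if x ∈ P then 1 else if θ x ∈ P then -1 else 0)
    {U : ℝ → ℝ} (hU : IsEvenSitePotential (fun _ : V => U)) (J : ℝ) :
    IsGinibreSystem (volume : Measure (V → ℝ)) (fun ψ => ψ) (fun s => ⇑(spinReflect s))
      (fun ψ => Real.exp (-(J * (1 / 2 * ∑ x, ∑ y, if G.Adj x y then
          (if ε x * ε y = -1 then ψ (τ x) * ψ (τ y) else 0) else 0))) *
        Real.exp (-∑ w, U (L ψ w))) where
  measurable := measurable_id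
  measurePreserving s :=
    measurePreserving_linear_of_comp_self volume (spinReflect s) (spinReflect_comp_self s)
  apply_flip s ψ := by simp [spinReflect_apply]
  apply_of_ne s t hts ψ := by simp [spinReflect_apply, hts]
  measurable_weight := by
    refine (Real.measurable_exp.comp ((measurable_crossSum τ ε G).const_mul J).neg).mul
      (Real.measurable_exp.comp (Finset.measurable_sum _ fun w _ => ?_).neg)
    exact (hU.measurable w).comp (measurable_apply_foldMap θ P L hL w)
  weight_nonneg ψ := mul_nonneg (Real.exp_nonneg _) (Real.exp_nonneg _)
  weight_flip s ψ := by
    have hUe : ∀ u, U (-u) = U u := hU.even s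
    rw [crossSum_spinReflect θ P τ ε G hθ hP hedge hτ hε s ψ,
      sum_apply_foldMap_spinReflect θ P L hθ hP hcov hL hUe s ψ]

/-- **The integrability hypothesis (4.1.4) of the folded system**: for an interaction `H'` of
quadratic growth and `J ≥ 0`, `|ψ|^m e^{H'(|ψ|)} e^{-J N(ψ)} ∏ e^{-U((Lψ)_w)}` is Lebesgue
integrable (change of variables back to `φ = Lψ` and Gaussian domination). [cite: GlimmJaffeQP1987, §4.1 (4.1.4)] -/
theorem integrable_fold (hθ : ∀ u, θ (θ u) = u) (hP : ∀ u ∈ P, θ u ∉ P)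
    (hcov : ∀ u, u ∈ P ∨ θ u ∈ P ∨ θ u = u)
    (hedge : ∀ u ∈ P, ∀ v ∈ P, G.Adj u (θ v) → u = v)
    (hL : ∀ ψ w, L ψ w = if w ∈ P then ψ w + ψ (θ w) else if θ w ∈ P then ψ (θ w) - ψ w else ψ w)
    (hτ : ∀ x, τ x = if x ∈ P then θ x else x)
    (hε : ∀ x, ε x = if x ∈ P then 1 else if θ x ∈ P then -1 else 0)
    {U : ℝ → ℝ} (hU : IsEvenSitePotential (fun _ : V => U)) {J : ℝ} (hJ : 0 ≤ J)
    {H' : MvPolynomial V ℝ} (hH'q : HasQuadraticGrowth H') (m : V →₀ ℕ) :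
    Integrable (fun ψ : V → ℝ => (∏ s, |ψ s| ^ m s) * Real.exp (eval (fun s => |ψ s|) H') *
      (Real.exp (-(J * (1 / 2 * ∑ x, ∑ y, if G.Adj x y then
          (if ε x * ε y = -1 then ψ (τ x) * ψ (τ y) else 0) else 0))) *
        Real.exp (-∑ w, U (L ψ w)))) := by
  obtain ⟨C, hC0, hC⟩ := hH'q
  set a : ℝ := (∑ s, m s : ℕ) + C with ha
  have ha0 : 0 ≤ a := by positivity
  -- the unfolding map and the change of variables
  set M : (V → ℝ) → (V → ℝ) := fun φ w =>
    if w ∈ P then (φ w + φ (θ w)) / 2 else if θ w ∈ P then (φ (θ w) - φ w) / 2 else φ w with hMdef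
  have hM : ∀ φ w, M φ w =
      if w ∈ P then (φ w + φ (θ w)) / 2 else if θ w ∈ P then (φ (θ w) - φ w) / 2 else φ w :=
    fun _ _ => rfl
  have hMm : ∀ w, Measurable fun φ : V → ℝ => M φ w := by
    intro w
    simp only [hMdef]
    split_ifs
    · exact ((measurable_pi_apply w).add (measurable_pi_apply (θ w))).div_const _
    · exact ((measurable_pi_apply (θ w)).sub (measurable_pi_apply w)).div_const _
    · exact measurable_pi_apply w
  obtain ⟨c, -, hcv⟩ := exists_integral_comp_foldMap θ P L hθ hP hL
  -- the dominating function `e^C · e^{a ∑ ψ²} e^{-∑ U((Lψ)_w)}` is integrable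
  set Fφ : (V → ℝ) → ℝ := fun φ => Real.exp (a * ∑ w, M φ w ^ 2) * Real.exp (-∑ w, U (φ w))
    with hFφ
  have hFφ_int : Integrable Fφ := by
    refine (hU.integrable_exp_mul_sum_sq a).mono' ?_ (Eventually.of_forall fun φ => ?_)
    · exact ((Real.measurable_exp.comp ((Finset.measurable_sum _ fun w _ =>
        (hMm w).pow_const 2).const_mul a)).mul (measurable_expNegSum hU.measurable)).aestronglyMeasurable
    · rw [Real.norm_of_nonneg (mul_nonneg (Real.exp_nonneg _) (Real.exp_nonneg _))]
      refine mul_le_mul_of_nonneg_right (Real.exp_le_exp.2 ?_) (Real.exp_nonneg _)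
      exact mul_le_mul_of_nonneg_left (sum_unfoldMap_sq_le θ P M hcov hM φ) ha0
  have hdom_int : Integrable (fun ψ : V → ℝ =>
      Real.exp (a * ∑ w, ψ w ^ 2) * Real.exp (-∑ w, U (L ψ w))) := by
    have h := (hcv Fφ).2.2 hFφ_int
    refine h.congr (Eventually.of_forall fun ψ => ?_)
    simp only [hFφ]
    rw [unfoldMap_foldMap θ P L M hθ hP hL hM ψ]
  refine (hdom_int.const_mul (Real.exp C)).mono' ?_ (Eventually.of_forall fun ψ => ?_)
  · refine (((Finset.measurable_prod _ fun s _ => ((measurable_pi_apply s).abs).pow_const _).mul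
      (Real.measurable_exp.comp ((MvPolynomial.continuous_eval H').measurable.comp
        (measurable_pi_lambda _ fun s => (measurable_pi_apply s).abs)))).mul
      (isGinibreSystem_fold θ P L τ ε G hθ hP hcov hedge hL hτ hε hU J).measurable_weight).aestronglyMeasurable
  · have hN := crossSum_nonneg θ P τ ε G hθ hP hedge hτ hε ψ
    have hprod := prod_abs_pow_le_exp ψ m
    have hq : eval (fun s => |ψ s|) H' ≤ C * (1 + ∑ s, ψ s ^ 2) := by
      have := hC (fun s => |ψ s|) fun s => abs_nonneg _
      simpa only [sq_abs] using this
    have h0 : 0 ≤ ∏ s, |ψ s| ^ m s := Finset.prod_nonneg fun s _ => pow_nonneg (abs_nonneg _) _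
    have hexpN : Real.exp (-(J * (1 / 2 * ∑ x, ∑ y, if G.Adj x y then
        (if ε x * ε y = -1 then ψ (τ x) * ψ (τ y) else 0) else 0))) ≤ 1 :=
      Real.exp_le_one_iff.2 (neg_nonpos.2 (mul_nonneg hJ hN))
    rw [Real.norm_of_nonneg (mul_nonneg (mul_nonneg h0 (Real.exp_nonneg _))
      (mul_nonneg (Real.exp_nonneg _) (Real.exp_nonneg _)))]
    calc (∏ s, |ψ s| ^ m s) * Real.exp (eval (fun s => |ψ s|) H') *
          (Real.exp (-(J * (1 / 2 * ∑ x, ∑ y, if G.Adj x y then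
            (if ε x * ε y = -1 then ψ (τ x) * ψ (τ y) else 0) else 0))) *
            Real.exp (-∑ w, U (L ψ w)))
        ≤ Real.exp ((∑ s, m s : ℕ) * ∑ s, ψ s ^ 2) * Real.exp (C * (1 + ∑ s, ψ s ^ 2)) *
            (1 * Real.exp (-∑ w, U (L ψ w))) := by
          gcongr
      _ = Real.exp C * (Real.exp (a * ∑ w, ψ w ^ 2) * Real.exp (-∑ w, U (L ψ w))) := by
          rw [one_mul, ← Real.exp_add, ha]
          rw [show ((∑ s, m s : ℕ) : ℝ) * ∑ s, ψ s ^ 2 + C * (1 + ∑ s, ψ s ^ 2) =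
            C + (((∑ s, m s : ℕ) : ℝ) + C) * ∑ w, ψ w ^ 2 by ring, Real.exp_add]
          ring

end Ginibre

end Fold

/-! ### The Messager–Miracle-Solé inequality -/

section MMS

variable {V : Type*} [Fintype V] [DecidableEq V]

/-- **The Messager–Miracle-Solé inequality for real-valued spins (un-normalised form).** Let `θ`
be an involution of the sites preserving the adjacency of the finite graph `G`, `P` an open
positive side (`θP ∩ P = ∅`, `V = P ∪ θP ∪ Fix(θ)`) such that no bond joins `P` to `θP` except the
bonds `{u, θu}`; let `U` be an even single-site potential dominating Gaussians and `J ≥ 0`. Then for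
`a ∈ P ∪ Fix(θ)` and `b ∈ P`,
`0 ≤ ∫ φ_a (φ_b - φ_{θb}) e^{J ∑_{E(G)} φφ} ∏_w e^{-U(φ_w)} dφ`
(in the folded variables the integrand is a nonnegative-coefficient polynomial times the even
weight, and the first Griffiths inequality of the folded Ginibre system applies). [cite: MessagerMiracleSoleJSP1977, main theorem (monotonicity under reflections)] [cite: Hegerfeldt1977, §2, Main Lemma, eq. (2.8)] [cite: AizenmanDuminilCopinAnnals2021, §5.1, (5.1) (real-valued spins)] -/
theorem integral_mul_sub_reflect_mul_boltzWeight_nonneg (θ : Equiv.Perm V) (P : Finset V)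
    (G : SimpleGraph V) [DecidableRel G.Adj]
    (hθ : ∀ u, θ (θ u) = u) (hP : ∀ u ∈ P, θ u ∉ P) (hcov : ∀ u, u ∈ P ∨ θ u ∈ P ∨ θ u = u)
    (hadj : ∀ x y, G.Adj (θ x) (θ y) ↔ G.Adj x y)
    (hedge : ∀ u ∈ P, ∀ v ∈ P, G.Adj u (θ v) → u = v)
    {U : ℝ → ℝ} (hU : IsEvenSitePotential (fun _ : V => U)) {J : ℝ} (hJ : 0 ≤ J)
    {a b : V} (ha : a ∈ P ∨ θ a = a) (hb : b ∈ P) :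
    0 ≤ ∫ φ, φ a * (φ b - φ (θ b)) * boltzWeight (fun _ => U) (J • pairPoly G) φ := by
  classical
  -- the bookkeeping functions with their defining equations
  set L : (V → ℝ) → (V → ℝ) := fun ψ w =>
    if w ∈ P then ψ w + ψ (θ w) else if θ w ∈ P then ψ (θ w) - ψ w else ψ w with hLdef
  have hL : ∀ ψ w, L ψ w =
      if w ∈ P then ψ w + ψ (θ w) else if θ w ∈ P then ψ (θ w) - ψ w else ψ w := fun _ _ => rfl
  set ρ : V → V := fun x => if x ∈ P then x else if θ x ∈ P then θ x else x with hρdef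
  have hρ : ∀ x, ρ x = if x ∈ P then x else if θ x ∈ P then θ x else x := fun _ => rfl
  set τ : V → V := fun x => if x ∈ P then θ x else x with hτdef
  have hτ : ∀ x, τ x = if x ∈ P then θ x else x := fun _ => rfl
  set ε : V → ℝ := fun x => if x ∈ P then 1 else if θ x ∈ P then -1 else 0 with hεdef
  have hε : ∀ x, ε x = if x ∈ P then 1 else if θ x ∈ P then -1 else 0 := fun _ => rfl
  obtain ⟨c, hc, hcv⟩ := exists_integral_comp_foldMap θ P L hθ hP hL
  set F : (V → ℝ) → ℝ := fun φ => φ a * (φ b - φ (θ b)) *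
    boltzWeight (fun _ => U) (J • pairPoly G) φ with hF
  -- the folded interaction polynomial
  set H' : MvPolynomial V ℝ := (J / 2) • ∑ x, ∑ y,
    (if G.Adj x y then (X (ρ x) * X (ρ y) +
      (if ε x * ε y = 1 then X (τ x) * X (τ y) else 0)) else 0) with hH'
  have hH'f : IsFerromagnetic H' := by
    refine IsFerromagnetic.smul (by positivity) (IsFerromagnetic.sum _ fun x _ =>
      IsFerromagnetic.sum _ fun y _ => ?_)
    split_ifs
    · exact ((IsFerromagnetic.X _).mul (IsFerromagnetic.X _)).add
        ((IsFerromagnetic.X _).mul (IsFerromagnetic.X _))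
    · exact ((IsFerromagnetic.X _).mul (IsFerromagnetic.X _)).add IsFerromagnetic.zero
    · exact IsFerromagnetic.zero
  have hevalH' : ∀ χ : V → ℝ, eval χ H' = J / 2 * ∑ x, ∑ y, if G.Adj x y then
      (χ (ρ x) * χ (ρ y) + (if ε x * ε y = 1 then χ (τ x) * χ (τ y) else 0)) else 0 := by
    intro χ
    simp only [hH', smul_eval, map_sum]
    congr 1
    refine Finset.sum_congr rfl fun x _ => Finset.sum_congr rfl fun y _ => ?_
    split_ifs <;> simp
  have hH'q : HasQuadraticGrowth H' := by
    refine ⟨J * (Fintype.card V : ℝ) ^ 2, by positivity, fun x hx => ?_⟩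
    rw [hevalH']
    set S := ∑ s, x s ^ 2 with hS
    have hsq : ∀ p : V, x p ^ 2 ≤ S := fun p =>
      Finset.single_le_sum (fun z _ => sq_nonneg (x z)) (Finset.mem_univ p)
    have hpq : ∀ p q : V, x p * x q ≤ S := fun p q => by
      nlinarith [hsq p, hsq q, sq_nonneg (x p - x q)]
    have hterm : ∀ u v : V, (if G.Adj u v then
        (x (ρ u) * x (ρ v) + (if ε u * ε v = 1 then x (τ u) * x (τ v) else 0)) else 0) ≤ 2 * S := by
      intro u v
      have hS0 : 0 ≤ S := Finset.sum_nonneg fun z _ => sq_nonneg (x z)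
      split_ifs
      · nlinarith [hpq (ρ u) (ρ v), hpq (τ u) (τ v)]
      · nlinarith [hpq (ρ u) (ρ v)]
      · linarith
    calc J / 2 * ∑ u, ∑ v, (if G.Adj u v then
          (x (ρ u) * x (ρ v) + (if ε u * ε v = 1 then x (τ u) * x (τ v) else 0)) else 0)
        ≤ J / 2 * ∑ _u : V, ∑ _v : V, 2 * S := by
          refine mul_le_mul_of_nonneg_left ?_ (by positivity)
          exact Finset.sum_le_sum fun u _ => Finset.sum_le_sum fun v _ => hterm u v
      _ = J * (Fintype.card V : ℝ) ^ 2 * S := by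
          simp only [Finset.sum_const, Finset.card_univ, nsmul_eq_mul]
          ring
      _ ≤ J * (Fintype.card V : ℝ) ^ 2 * (1 + S) := by
          refine mul_le_mul_of_nonneg_left (by linarith) (by positivity)
  -- the folded observable polynomial
  set p' : MvPolynomial V ℝ :=
    if a ∈ P then C 2 * X (θ b) * (X a + X (θ a)) else C 2 * X (θ b) * X a with hp'
  have hp'f : IsFerromagnetic p' := by
    simp only [hp']
    split_ifs
    · exact ((IsFerromagnetic.C (by norm_num)).mul (IsFerromagnetic.X _)).mul
        ((IsFerromagnetic.X _).add (IsFerromagnetic.X _))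
    · exact ((IsFerromagnetic.C (by norm_num)).mul (IsFerromagnetic.X _)).mul (IsFerromagnetic.X _)
  have hθb : θ b ∉ P := hP b hb
  have hevalp' : ∀ ψ : V → ℝ, eval ψ p' = L ψ a * (L ψ b - L ψ (θ b)) := by
    intro ψ
    have hdiff : L ψ b - L ψ (θ b) = 2 * ψ (θ b) := by
      rw [hL, hL, if_pos hb, if_neg hθb, hθ, if_pos hb]
      ring
    rw [hdiff]
    rcases ha with ha | ha
    · rw [hp', if_pos ha, hL, if_pos ha]
      simp only [map_mul, map_add, eval_C, eval_X]
      ring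
    · have haP : a ∉ P := fun h => hP a h (ha.symm ▸ h)
      rw [hp', if_neg haP, hL, if_neg haP, ha, if_neg haP]
      simp only [map_mul, eval_C, eval_X]
      ring
  -- GKS I in the folded Ginibre system
  have hGin := isGinibreSystem_fold θ P L τ ε G hθ hP hcov hedge hL hτ hε hU J
  have hint := fun m => integrable_fold θ P L τ ε G hθ hP hcov hedge hL hτ hε hU hJ hH'q m
  have h := hGin.integral_eval_mul_exp_mul_weight_nonneg hp'f hH'f hint
  -- identify the integrand with `F ∘ L`
  have hFL : ∀ ψ : V → ℝ, eval ψ p' * Real.exp (eval ψ H') *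
      (Real.exp (-(J * (1 / 2 * ∑ x, ∑ y, if G.Adj x y then
          (if ε x * ε y = -1 then ψ (τ x) * ψ (τ y) else 0) else 0))) *
        Real.exp (-∑ w, U (L ψ w))) = F (L ψ) := by
    intro ψ
    have hpair := mul_pairInteraction_foldMap θ P L ρ τ ε G hθ hP hcov hadj hL hρ hτ hε J ψ
    have hBw : boltzWeight (fun _ : V => U) (J • pairPoly G) (L ψ) =
        Real.exp (J * pairInteraction G (L ψ)) * Real.exp (-∑ w, U (L ψ w)) := by
      rw [boltzWeight, smul_eval, eval_pairPoly]
    rw [hF, hevalp']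
    simp only
    rw [hBw, hpair, hevalH', Real.exp_sub, Real.exp_neg]
    ring
  have key : 0 ≤ ∫ ψ, F (L ψ) := by
    refine h.trans_eq (integral_congr_ae (Eventually.of_forall fun ψ => ?_))
    exact hFL ψ
  rw [(hcv F).1] at key
  exact (mul_nonneg_iff_of_pos_left hc).1 key

/-- **The Messager–Miracle-Solé inequality for the lattice `φ⁴` measure** (Aizenman–Duminil-Copin
2021, §5.1, (5.1), for the two-point function of "real valued spin variables", here
`e^{-gφ⁴-κφ²} dφ`, `g > 0`): under the hypotheses of
`integral_mul_sub_reflect_mul_boltzWeight_nonneg`, for `J ≥ 0`, `a ∈ P ∪ Fix(θ)` and `b ∈ P`,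
`⟨φ_a φ_{θb}⟩_{G;g,κ,J} ≤ ⟨φ_a φ_b⟩_{G;g,κ,J}`. [cite: AizenmanDuminilCopinAnnals2021, §5.1, display (5.1) and Prop. 5.1 (p. 16)] [cite: MessagerMiracleSoleJSP1977, main theorem] [cite: Hegerfeldt1977, Thm. 3.1–3.2] -/
theorem phi4_twoPoint_reflect_le (θ : Equiv.Perm V) (P : Finset V) (G : SimpleGraph V)
    [DecidableRel G.Adj] (hθ : ∀ u, θ (θ u) = u) (hP : ∀ u ∈ P, θ u ∉ P)
    (hcov : ∀ u, u ∈ P ∨ θ u ∈ P ∨ θ u = u) (hadj : ∀ x y, G.Adj (θ x) (θ y) ↔ G.Adj x y)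
    (hedge : ∀ u ∈ P, ∀ v ∈ P, G.Adj u (θ v) → u = v) {g : ℝ} (hg : 0 < g) (κ : ℝ) {J : ℝ}
    (hJ : 0 ≤ J) {a b : V} (ha : a ∈ P ∨ θ a = a) (hb : b ∈ P) :
    ∫ φ, φ a * φ (θ b) ∂(phi4Measure G g κ J) ≤ ∫ φ, φ a * φ b ∂(phi4Measure G g κ J) := by
  have hU : IsEvenSitePotential (fun _ : V => fun u : ℝ => g * u ^ 4 + κ * u ^ 2) :=
    isEvenSitePotential_phi4 hg κ
  have h := integral_mul_sub_reflect_mul_boltzWeight_nonneg θ P G hθ hP hcov hadj hedge hU hJ ha hb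
  have hB : ∀ φ : V → ℝ, boltzWeight (fun _ : V => fun u : ℝ => g * u ^ 4 + κ * u ^ 2)
      (J • pairPoly G) φ = Real.exp (-phi4Action G g κ J φ) := boltzWeight_phi4 G g κ J
  simp only [hB] at h
  -- integrability of the two monomials against `e^{-S}`
  have hH := (isFerromagnetic_pairPoly G).smul hJ
  have hHq := (hasQuadraticGrowth_pairPoly G).smul hJ
  have hI : ∀ u v : V, Integrable (fun φ : V → ℝ => φ u * φ v * Real.exp (-phi4Action G g κ J φ)) := by
    intro u v
    have hi := hU.integrable_eval_mul_boltzWeight hH hHq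
      ((IsFerromagnetic.X u).mul (IsFerromagnetic.X (σ := V) v))
    simp only [map_mul, eval_X, hB] at hi
    exact hi
  have hsplit : ∫ φ : V → ℝ, φ a * (φ b - φ (θ b)) * Real.exp (-phi4Action G g κ J φ) =
      (∫ φ : V → ℝ, φ a * φ b * Real.exp (-phi4Action G g κ J φ)) -
        ∫ φ : V → ℝ, φ a * φ (θ b) * Real.exp (-phi4Action G g κ J φ) := by
    rw [← integral_sub (hI a b) (hI a (θ b))]
    refine integral_congr_ae (Eventually.of_forall fun φ => ?_)
    simp only
    ring
  rw [hsplit] at h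
  rw [integral_phi4Measure, integral_phi4Measure]
  exact div_le_div_of_nonneg_right (by linarith) (phi4_partitionFunction_pos G hg κ J).le

end MMS

end Literature.MathematicalPhysics.QuantumLattice
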